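import Literature.AnabelianGeometry.SemiGraphs.ProSigmaCompletionNormalCentralizerLevel
import Literature.AnabelianGeometry.AbsoluteAnabelian.FreeProSigmaNonVacuity
import HarnessLib

/-!
# Pro-`Σ` completions of nonabelian free groups: non-trivial NORMAL subgroups have trivial centraliser
# («(H′)» of the [AbsTopI] Thm 2.6 «`Δ ⊆ Π` characteristic» route, PROVED; free profinite groups `F̂_n`, `n ≥ 2`)

[AbsAnab] (S. Mochizuki, *The absolute anabelian geometry of hyperbolic curves*, 2004), Lemma 1.3.1 p. 15
("`Δ_X`, `Π_X` are slim") [cite: MochizukiAbsAnab2004, Lemma 1.3.1 p.15]; [AbsTopI] Lemma 4.5 (i) p. 54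
("free pro-`Σ`") [cite: MochizukiAbsTopI2012, Lemma 4.5 (i) p.54]; the classical statement is
Ribes–Zalesskii, *Profinite Groups* (2nd ed. 2010) §8.6–8.7 (centralisers / normal subgroups of free
profinite groups), there proved with cohomological dimension and Melnikov's theorem.  Cell `abc-iut`, seat
abc-iut-w4-d044 (gen 7), row «HPRIME-PROVED» (abc-iut-L6-lead §F v1.19cc; MCHAR route custody §F v1.19bw (4),
abc-iut-L2-lead R565/R738): the named hypothesis «(H′)» of abc-iut-w6-d055's
`AbsTopIThm26GeomCentralizerRoute.lean` becomes a THEOREM.  PROOF-ONLY (no definition, no instance, no named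
fact); sequel of `ProSigmaCompletionNormalCentralizerLevel.lean` (Step A); `exists_openNormal_not_mem_zpowers`,
`center_eq_bot`, `restrict_isOpen` (abc-iut-L5-t9), `isProSigmaCompletion_toCompletion` (abc-iut-L3/L5),
`IsFreeProOn.isProSigmaCompletion_lift` (abc-iut-L4-t15's bridge) consumed BY NAME.

WHAT IS SHOWN (`ι : Γ → P` a pro-`Σ` completion of a NONABELIAN free group, `P` profinite, `Σ` UNBOUNDED —
`∀ m ∃ p ∈ Σ prime, m < p`, e.g. `Σ = 𝔓𝔯𝔦𝔪𝔢𝔰`):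
* `mk_mem_zpowers_mk_of_le` — powers of a class descend to coarser levels (bookkeeping);
* `eq_one_of_forall_conj_mk_mem_zpowers` (Step C) — if every conjugate of `y` is, at every finite level, a
  power of `s̄ = ι(a)‾` for one free generator `a`, then `y = 1` (coordinate character `χ`, `χ(s) = 1`:
  `[g, y] ∈ W₀` for every open normal `W₀`, so `y ∈ Z(P) = 1`);
* **`centralizer_eq_bot_of_normal`** — EVERY normal subgroup `N ≠ 1` of `P` (closed or not) has
  `Z_P(N) = 1`.  (For `z ∈ Z_P(N)`, `z ≠ 1`, the separation lemma gives a generator `a` and a level at which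
  `z̄ ∉ ⟨s̄⟩`; if some `y ∈ N` escapes `⟨s̄⟩` at some level, Step A at the common refinement is contradicted;
  otherwise `N = 1` by Step C.)  `eq_bot_of_commute_of_normal` — the «no commuting partner» form;
  `centralizer_eq_bot_of_normal_of_isOpen` — the same inside every OPEN subgroup `U ⊆ P` (Nielsen–Schreier);
* COROLLARIES BY NAME: `centralizer_eq_bot_of_normal_profiniteCompletion_freeGroup` — (H′) for
  `F̂_n = profiniteCompletion (FreeGroup (Fin n))`, `n ≥ 2`; `…_of_isOpen_profiniteCompletion_freeGroup` — for
  open subgroups of `F̂_n`; `centralizer_eq_bot_of_normal_of_isFreeProOn` — for profinite groups free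
  pro-`𝔓𝔯𝔦𝔪𝔢𝔰` of rank `≥ 2` in the L4 sense `IsFreeProOn` ([AbsTopI] Lemma 4.5 (i)).
The consumer-facing form for `FundamentalExtension.MLFBase.preservesGeom_or_exists_commuting_pair` (p473904)
is in `AbsoluteAnabelian/AbsTopIThm26GeomCentralizerRouteFree.lean`.

HONEST FRAMING: classical (pro)finite group theory; refereed, undisputed; nothing here bears on [IUTchIII]
Cor. 3.12 or takes a side; typed ≠ proved elsewhere; nothing asserts abc proved or refuted.
-/

namespace Literature.AnabelianGeometry.SemiGraphs.SemiGraphOfAnabelioids.IsProSigmaCompletion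

open Literature.AnabelianGeometry.Anabelioids Literature.AlgebraicGeometry.Frobenioids Topology
open Multiplicative
open Literature.GroupTheory.CombinatorialGroupTheory (exists_generators_ne
  exists_not_commute_of_finiteIndex_of_isFreeGroup)

/-! ### Powers of a class at two finite levels -/

section Levels

variable {G : Type*} [Group G]

/-- If `x̄` is a power of `s̄` modulo `W`, it is so modulo any coarser `W' ⊇ W`. [folklore] -/
private theorem mk_mem_zpowers_mk_of_le {W W' : Subgroup G} [W.Normal] [W'.Normal] (hle : W ≤ W') {s x : G}
    (h : (QuotientGroup.mk x : G ⧸ W) ∈ Subgroup.zpowers (QuotientGroup.mk s)) :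
    (QuotientGroup.mk x : G ⧸ W') ∈ Subgroup.zpowers (QuotientGroup.mk s) := by
  obtain ⟨k, hk⟩ := Subgroup.mem_zpowers_iff.mp h
  refine Subgroup.mem_zpowers_iff.mpr ⟨k, ?_⟩
  rw [← QuotientGroup.mk_zpow, QuotientGroup.eq] at hk ⊢
  exact hle hk

end Levels

variable {Sigma : Set ℕ} {Γ : Type*} [Group Γ] {P : Type*} [Group P] [TopologicalSpace P]
  {ι : Γ →* P}

section Profinite

variable [IsTopologicalGroup P] [CompactSpace P] [TotallyDisconnectedSpace P]

/-! ### Step C: a normal subgroup inside the pro-cyclic closure of a generator is central -/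

/-- **Central elements from a generator coordinate.**  Let `Γ` be free and nonabelian, `ι : Γ → P` a
pro-`Σ` completion (`P` profinite), `a` a free generator, `s = ι(a)`, and `y ∈ P` an element ALL of whose
conjugates are, at every finite level, powers of `s̄`.  Then `y = 1`.  (With the coordinate character
`χ : P → ℤ/[P:W₀]`, `χ(s) = 1`, vanishing on the other generators: `g y g⁻¹ ≡ s^{k'}`, `y ≡ s^{k}` at the
level `W₀ ∩ Ker χ` give `k ≡ χ(y) ≡ k'`, so `[g, y] ∈ W₀` for every `W₀`; hence `y` is central, and
`Z(P) = 1` by `center_eq_bot`.) [cite: MochizukiAbsAnab2004, Lemma 1.3.1 p.15] -/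
theorem eq_one_of_forall_conj_mk_mem_zpowers [IsFreeGroup Γ] [T2Space P] (hΓ : ∃ x y : Γ, x * y ≠ y * x)
    (hι : IsProSigmaCompletion Sigma ι) (a : IsFreeGroup.Generators Γ) {y : P}
    (hy : ∀ (g : P) (W : OpenNormalSubgroup P),
      (QuotientGroup.mk (g * y * g⁻¹) : P ⧸ (W : Subgroup P)) ∈
        Subgroup.zpowers (QuotientGroup.mk (ι (IsFreeGroup.of a)))) :
    y = 1 := by
  classical
  set s : P := ι (IsFreeGroup.of a) with hsdef
  -- it suffices that `y` be central
  suffices hcen : y ∈ Subgroup.center P by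
    rw [center_eq_bot hΓ hι] at hcen
    exact Subgroup.mem_bot.mp hcen
  rw [Subgroup.mem_center_iff]
  intro g
  -- `c = g y g⁻¹ y⁻¹` lies in every open normal subgroup, hence is trivial
  suffices hc : ∀ W₀ : OpenNormalSubgroup P, g * y * g⁻¹ * y⁻¹ ∈ (W₀ : Subgroup P) by
    by_contra hne
    have hc1 : g * y * g⁻¹ * y⁻¹ ≠ 1 := fun h => hne (mul_inv_eq_iff_eq_mul.mp (mul_inv_eq_one.mp h))
    obtain ⟨W₀, hW₀⟩ := ProfiniteGrp.exist_openNormalSubgroup_sub_open_nhds_of_one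
      (isOpen_compl_singleton (x := g * y * g⁻¹ * y⁻¹))
      (show (1 : P) ∈ ({g * y * g⁻¹ * y⁻¹}ᶜ : Set P) from fun h => hc1 h.symm)
    exact hW₀ (hc W₀) rfl
  intro W₀
  haveI : (W₀ : Subgroup P).Normal := W₀.isNormal'
  obtain ⟨n, hndef⟩ : ∃ n, n = (W₀ : Subgroup P).index := ⟨_, rfl⟩
  have hn : IsSigmaInteger Sigma n := hndef ▸ hι.index_open _ W₀.isNormal' W₀.isOpen'
  haveI : NeZero n := ⟨hn.1.ne'⟩
  have hcard : IsSigmaInteger Sigma (Nat.card (Multiplicative (ZMod n))) := by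
    rw [show Nat.card (Multiplicative (ZMod n)) = n from Nat.card_zmod n]; exact hn
  -- the coordinate character `χ`, `χ(s) = 1`, extended continuously to `P`
  let χ₀ : Γ →* Multiplicative (ZMod n) :=
    IsFreeGroup.lift fun b => if b = a then ofAdd (1 : ZMod n) else 1
  have hχ₀ : χ₀ (IsFreeGroup.of a) = ofAdd 1 := by simp [χ₀]
  obtain ⟨χ, hχc, hχ⟩ := exists_continuous_extend_top hι hcard χ₀
  have hχs : χ s = ofAdd 1 := by rw [hsdef, hχ, hχ₀]
  have hk₁ : IsOpen (χ.ker : Set P) := (isOpen_discrete ({1} : Set _)).preimage hχc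
  let K₁ : OpenNormalSubgroup P := { toSubgroup := χ.ker, isOpen' := hk₁ }
  let W : OpenNormalSubgroup P := W₀ ⊓ K₁
  have hWle₀ : (W : Subgroup P) ≤ (W₀ : Subgroup P) := fun x hx => hx.1
  have hWleχ : (W : Subgroup P) ≤ χ.ker := fun x hx => hx.2
  -- the two memberships at the level `W = W₀ ∩ Ker χ`
  obtain ⟨k', hk'⟩ := Subgroup.mem_zpowers_iff.mp (hy g W)
  have hy1 := hy 1 W
  rw [one_mul, inv_one, mul_one] at hy1
  obtain ⟨k, hk⟩ := Subgroup.mem_zpowers_iff.mp hy1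
  have hk'W : (s ^ k')⁻¹ * (g * y * g⁻¹) ∈ (W : Subgroup P) := by
    rw [← QuotientGroup.eq, QuotientGroup.mk_zpow]; exact hk'
  have hkW : (s ^ k)⁻¹ * y ∈ (W : Subgroup P) := by
    rw [← QuotientGroup.eq, QuotientGroup.mk_zpow]; exact hk
  -- apply `χ`: `χ y = k = k'` in `ℤ/n`
  have e1 : χ y = ofAdd ((k : ℤ) : ZMod n) := by
    have h := hWleχ hkW
    rw [MonoidHom.mem_ker, map_mul, map_inv, map_zpow, hχs, inv_mul_eq_one] at h
    rw [← h, ← ofAdd_zsmul, zsmul_one]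
  have e2 : χ y = ofAdd ((k' : ℤ) : ZMod n) := by
    have h := hWleχ hk'W
    rw [MonoidHom.mem_ker, map_mul, map_inv, map_zpow, hχs, inv_mul_eq_one, map_mul, map_mul, map_inv,
      mul_inv_cancel_comm] at h
    rw [← h, ← ofAdd_zsmul, zsmul_one]
  have hdvd : (n : ℤ) ∣ k' - k := by
    rw [e1] at e2
    exact (ZMod.intCast_eq_intCast_iff_dvd_sub _ _ _).mp (ofAdd.injective e2)
  -- conclude in `P ⧸ W₀`
  rw [← QuotientGroup.eq_one_iff]
  have h1 : (QuotientGroup.mk (g * y * g⁻¹) : P ⧸ (W₀ : Subgroup P)) = (QuotientGroup.mk s) ^ k' := by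
    rw [eq_comm, ← QuotientGroup.mk_zpow, QuotientGroup.eq]; exact hWle₀ hk'W
  have h2 : (QuotientGroup.mk y : P ⧸ (W₀ : Subgroup P)) = (QuotientGroup.mk s) ^ k := by
    rw [eq_comm, ← QuotientGroup.mk_zpow, QuotientGroup.eq]; exact hWle₀ hkW
  have hsn : (QuotientGroup.mk s : P ⧸ (W₀ : Subgroup P)) ^ (n : ℤ) = 1 := by
    rw [zpow_natCast, ← QuotientGroup.mk_pow, QuotientGroup.eq_one_iff, hndef]
    exact Subgroup.pow_index_mem _ _
  obtain ⟨t, ht⟩ := hdvd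
  rw [QuotientGroup.mk_mul, QuotientGroup.mk_inv, h1, h2, ← zpow_neg, ← zpow_add,
    show k' + -k = (n : ℤ) * t by omega, zpow_mul, hsn, one_zpow]

/-! ### The theorem -/

/-- **Non-trivial normal subgroups of the pro-`Σ` completion of a nonabelian free group have trivial
centraliser** (`Σ` unbounded, e.g. `Σ = 𝔓𝔯𝔦𝔪𝔢𝔰`; `P` profinite).  In particular: a non-trivial (closed or
not) normal subgroup of a FREE PROFINITE GROUP OF FINITE RANK `≥ 2` has trivial centraliser, and admits no
non-trivial elementwise-commuting partner — the classical input «(H′)» of the [AbsTopI] Thm 2.6 (iv)/(v)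
«`Δ ⊆ Π` characteristic» route (Ribes–Zalesskii, *Profinite Groups*, §8.6–8.7), proved here WITHOUT
cohomological dimension / projectivity / Melnikov's theorem.  (Take `z ∈ Z_P(N)`, `z ≠ 1`: by the
separation lemma some generator `a` and level `W₀` have `z̄ ∉ ⟨s̄⟩`; if some `y ∈ N` escapes `⟨s̄⟩` at some
level, Step A at the common refinement is contradicted; otherwise every conjugate of every `y ∈ N` is a
power of `s̄` at every level, so `N = 1` by Step C.)  Strengthens `isSlimGroup`/`center_eq_bot`.
[cite: MochizukiAbsAnab2004, Lemma 1.3.1 p.15] -/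
theorem centralizer_eq_bot_of_normal [IsFreeGroup Γ] [T2Space P] (hΓ : ∃ x y : Γ, x * y ≠ y * x)
    (hι : IsProSigmaCompletion Sigma ι) (hSig : ∀ m : ℕ, ∃ p ∈ Sigma, p.Prime ∧ m < p)
    (N : Subgroup P) [N.Normal] (hN : N ≠ ⊥) : Subgroup.centralizer (N : Set P) = ⊥ := by
  classical
  rw [eq_bot_iff]
  intro z hz
  rw [Subgroup.mem_bot]
  by_contra hz1
  obtain ⟨a₁, a₂, h12⟩ := exists_generators_ne hΓ
  obtain ⟨a, W₀, hzW₀⟩ := exists_openNormal_not_mem_zpowers hι h12 hz1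
  haveI : (W₀ : Subgroup P).Normal := W₀.isNormal'
  by_cases hex : ∃ y ∈ N, ∃ W₁ : OpenNormalSubgroup P,
      (QuotientGroup.mk y : P ⧸ (W₁ : Subgroup P)) ∉ Subgroup.zpowers (QuotientGroup.mk (ι (IsFreeGroup.of a)))
  · -- some `y ∈ N` escapes `⟨s̄⟩`: Step A at the common level
    obtain ⟨y, hyN, W₁, hyW₁⟩ := hex
    haveI : (W₁ : Subgroup P).Normal := W₁.isNormal'
    let W : OpenNormalSubgroup P := W₀ ⊓ W₁
    haveI : (W : Subgroup P).Normal := W.isNormal'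
    have hle₀ : (W : Subgroup P) ≤ (W₀ : Subgroup P) := fun x hx => hx.1
    have hle₁ : (W : Subgroup P) ≤ (W₁ : Subgroup P) := fun x hx => hx.2
    rcases mk_mem_zpowers_or_of_mem_centralizer hι hSig N (W : Subgroup P) W.isOpen' a hz hyN with h | h
    · exact hzW₀ (mk_mem_zpowers_mk_of_le hle₀ h)
    · exact hyW₁ (mk_mem_zpowers_mk_of_le hle₁ h)
  · -- every `y ∈ N` is a power of `s̄` at every level: `N` is trivial by Step C
    push Not at hex
    apply hN
    rw [eq_bot_iff]
    intro y hyN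
    rw [Subgroup.mem_bot]
    exact eq_one_of_forall_conj_mk_mem_zpowers hΓ hι a fun g W =>
      hex _ (Subgroup.Normal.conj_mem inferInstance y hyN g) W

/-- Equivalent form: in the pro-`Σ` completion of a nonabelian free group (`Σ` unbounded), a non-trivial
normal subgroup has NO non-trivial elementwise-commuting partner subgroup. [cite: MochizukiAbsAnab2004, Lemma 1.3.1 p.15] -/
theorem eq_bot_of_commute_of_normal [IsFreeGroup Γ] [T2Space P] (hΓ : ∃ x y : Γ, x * y ≠ y * x)
    (hι : IsProSigmaCompletion Sigma ι) (hSig : ∀ m : ℕ, ∃ p ∈ Sigma, p.Prime ∧ m < p)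
    (N S : Subgroup P) [N.Normal] (hN : N ≠ ⊥) (hcomm : ∀ r ∈ N, ∀ t ∈ S, r * t = t * r) : S = ⊥ := by
  rw [eq_bot_iff, ← centralizer_eq_bot_of_normal hΓ hι hSig N hN]
  intro t ht
  exact Subgroup.mem_centralizer_iff.mpr fun r hr => hcomm r hr t ht

/-- **Open subgroups.**  For `U ⊆ P` open (`P` the pro-`Σ` completion of a nonabelian free group, `Σ`
unbounded), every non-trivial subgroup of `U` that is normal IN `U` has trivial centraliser in `U`
(`ι⁻¹(U) → U` is again such a completion: `restrict_isOpen`, Nielsen–Schreier).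
[cite: MochizukiAbsAnab2004, Lemma 1.3.1 p.15] -/
theorem centralizer_eq_bot_of_normal_of_isOpen [IsFreeGroup Γ] [T2Space P] (hΓ : ∃ x y : Γ, x * y ≠ y * x)
    (hι : IsProSigmaCompletion Sigma ι) (hSig : ∀ m : ℕ, ∃ p ∈ Sigma, p.Prime ∧ m < p)
    (U : Subgroup P) (hU : IsOpen (U : Set P)) (N : Subgroup U) [N.Normal] (hN : N ≠ ⊥) :
    Subgroup.centralizer (N : Set U) = ⊥ := by
  have hιU := restrict_isOpen hι U hU
  haveI : CompactSpace U := isCompact_iff_compactSpace.mp (U.isClosed_of_isOpen hU).isCompact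
  haveI : (U.comap ι).FiniteIndex := finiteIndex_comap hι U hU
  obtain ⟨x, y, hxy⟩ := hΓ
  obtain ⟨x', hx', y', hy', hxy'⟩ := exists_not_commute_of_finiteIndex_of_isFreeGroup hxy (U.comap ι)
  have hΓU : ∃ u v : U.comap ι, u * v ≠ v * u :=
    ⟨⟨x', hx'⟩, ⟨y', hy'⟩, fun h => hxy' (congrArg Subtype.val h)⟩
  exact centralizer_eq_bot_of_normal hΓU hιU hSig N hN

end Profinite

/-! ### Corollaries by name: free profinite groups of finite rank `≥ 2` -/

section FreeProfinite

open Literature.IUT.HodgeTheaters (profiniteCompletion toCompletion)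
open Literature.AnabelianGeometry.AbsoluteAnabelian (IsFreeProOn)

/-- `𝔓𝔯𝔦𝔪𝔢𝔰` is unbounded. [folklore] -/
private theorem primes_unbounded : ∀ m : ℕ, ∃ p ∈ {p : ℕ | p.Prime}, p.Prime ∧ m < p := fun m => by
  obtain ⟨p, hmp, hp⟩ := Nat.exists_infinite_primes (m + 1)
  exact ⟨p, hp, hp, by omega⟩

/-- Two distinct free generators of `F_n` do not commute (seen in `S₃`). [folklore] -/
private theorem freeGroup_of_mul_of_ne' {n : ℕ} {i j : Fin n} (hij : i ≠ j) :
    (FreeGroup.of i : FreeGroup (Fin n)) * FreeGroup.of j ≠ FreeGroup.of j * FreeGroup.of i := by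
  classical
  let f : Fin n → Equiv.Perm (Fin 3) := fun c =>
    if c = i then Equiv.swap 0 1 else if c = j then Equiv.swap 1 2 else 1
  have hfi : f i = Equiv.swap 0 1 := by simp [f]
  have hfj : f j = Equiv.swap 1 2 := by simp [f, Ne.symm hij]
  intro hc
  have h' := congrArg (FreeGroup.lift f) hc
  simp only [map_mul, FreeGroup.lift_apply_of, hfi, hfj] at h'
  exact absurd h' (by decide)

/-- **(H′) for `F̂_n`**: in the free profinite group `F̂_n = profiniteCompletion (FreeGroup (Fin n))`,
`n ≥ 2`, every non-trivial normal subgroup has trivial centraliser.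
[cite: MochizukiAbsAnab2004, Lemma 1.3.1 p.15] -/
theorem centralizer_eq_bot_of_normal_profiniteCompletion_freeGroup (n : ℕ) (hn : 2 ≤ n)
    (N : Subgroup (profiniteCompletion (FreeGroup (Fin n)))) [N.Normal] (hN : N ≠ ⊥) :
    Subgroup.centralizer (N : Set (profiniteCompletion (FreeGroup (Fin n)))) = ⊥ := by
  have hne : (⟨0, by omega⟩ : Fin n) ≠ ⟨1, by omega⟩ := by simp [Fin.ext_iff]
  exact centralizer_eq_bot_of_normal ⟨_, _, freeGroup_of_mul_of_ne' hne⟩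
    (isProSigmaCompletion_toCompletion (FreeGroup (Fin n))) primes_unbounded N hN

/-- **(H′) for open subgroups of `F̂_n`** (`n ≥ 2`): a non-trivial subgroup of an open `U ⊆ F̂_n`, normal in
`U`, has trivial centraliser in `U`. [cite: MochizukiAbsAnab2004, Lemma 1.3.1 p.15] -/
theorem centralizer_eq_bot_of_normal_of_isOpen_profiniteCompletion_freeGroup (n : ℕ) (hn : 2 ≤ n)
    (U : Subgroup (profiniteCompletion (FreeGroup (Fin n))))
    (hU : IsOpen (U : Set (profiniteCompletion (FreeGroup (Fin n)))))
    (N : Subgroup U) [N.Normal] (hN : N ≠ ⊥) : Subgroup.centralizer (N : Set U) = ⊥ := by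
  have hne : (⟨0, by omega⟩ : Fin n) ≠ ⟨1, by omega⟩ := by simp [Fin.ext_iff]
  exact centralizer_eq_bot_of_normal_of_isOpen ⟨_, _, freeGroup_of_mul_of_ne' hne⟩
    (isProSigmaCompletion_toCompletion (FreeGroup (Fin n))) primes_unbounded U hU N hN

/-- **(H′) in the L4 vocabulary**: a profinite group that is free pro-`𝔓𝔯𝔦𝔪𝔢𝔰` of rank `n ≥ 2` on
`gens` in the sense of [AbsTopI] Lemma 4.5 (i) (`IsFreeProOn`) has the property that every non-trivial
normal subgroup has trivial centraliser (via the bridge `IsFreeProOn.isProSigmaCompletion_lift`).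
[cite: MochizukiAbsTopI2012, Lemma 4.5 (i) p.54] -/
theorem centralizer_eq_bot_of_normal_of_isFreeProOn {G : Type*} [Group G] [TopologicalSpace G]
    [IsTopologicalGroup G] [CompactSpace G] [T2Space G] [TotallyDisconnectedSpace G]
    {n : ℕ} {gens : Fin n → G} (h : IsFreeProOn G {p : ℕ | p.Prime} gens) (hn : 2 ≤ n)
    (N : Subgroup G) [N.Normal] (hN : N ≠ ⊥) : Subgroup.centralizer (N : Set G) = ⊥ := by
  have hne : (⟨0, by omega⟩ : Fin n) ≠ ⟨1, by omega⟩ := by simp [Fin.ext_iff]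
  exact centralizer_eq_bot_of_normal ⟨_, _, freeGroup_of_mul_of_ne' hne⟩
    h.isProSigmaCompletion_lift primes_unbounded N hN

end FreeProfinite

end Literature.AnabelianGeometry.SemiGraphs.SemiGraphOfAnabelioids.IsProSigmaCompletion
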